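import Summits.ValiantsHypothesis.ValiantsHypothesis.Theorems.KPlusLogSqLawTropicalBMarkedEdgeCoreHeight
import Mathlib.GroupTheory.Perm.List

/-!
# Route «KPlusLogSqLaw», crux `TropicalB` (stmt-ValiantsHypothesis-19771) — MARKED-EDGE sector, NESTED-TRIANGLE CORE, ALL sizes:
# two engines for THEOREM D1 — the LENS RIGIDITY of a one-cycle pair, and the ACYCLICITY form of the height order

HONEST FRAMING.  Helper file (cell `pub-symmetroid`, seat val-sym-trop-p4 (g21), 2026-08-29; `--supports stmt-ValiantsHypothesis-19771 --as
helper`).  Pure combinatorics behind the located THEOREM D1 (memo HOME/val-sym-trop-p4/g20/PCD-DICHOTOMY-g20.md §7, this seat's memo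
RIGIDITY-g21.md): nothing here proves the nested-triangle law; nothing concerns `TropicalB` in its window, `WeakLifting`, the doors,
`MatrixDescartes` (stmt-ValiantsHypothesis-18050) or VP ≠ VNP.

* `agree_off_of_isCycle` — **LENS RIGIDITY.**  If `σ₁⁻¹σ₂` is a cycle (the kernel form of the pair exchanges `core_BC_isCycle`,
  `core_BE_isCycle`, `core_CE_isCycle`) and `S` is a set of nodes with `σ₂ S ⊆ σ₁ S` containing a node where `σ₁, σ₂` differ, then
  `σ₁ = σ₂` OFF `S`.  Reading: two colours that form a «lens» (two arc-paths with the same end points whose private nodes are fixed by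
  the other colour) agree everywhere else — the engine of the RIGIDITY LEMMA A of the memo (two colours agree along their `b4`-chains up
  to any common node that is unreachable from `b0`).
* `core_noRelCycle` — **ACYCLICITY (the height order, list form).**  In a realisation of the core there is no cyclic list of nodes
  avoiding the gates `b0, b4` along which every step `i ↦ next i` is a relative arc, i.e. `σZ (next i) ∈ {σB i, σC i, σE i}`: the cover
  `σZ · formPerm l` would use both gate loops and differ from `σZ`, against `core_BCEZ_unique`.  This is the statement that makes
  `σZ⁻¹σB, σZ⁻¹σC, σZ⁻¹σE` simultaneously «rising» along one linear order of `V ∖ {b0, b4}`.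
-/

set_option linter.dupNamespace false
set_option autoImplicit false

namespace Summit.ValiantsHypothesis.ValiantsHypothesis.Theorems.KPlusLogSqLaw
namespace MarkedEdge
namespace Core

open Finset

variable {V : Type*} [Fintype V] [DecidableEq V]

omit [Fintype V] [DecidableEq V] in
/-- Iterates of `σ₁⁻¹σ₂` stay inside a set `S` with `σ₂ S ⊆ σ₁ S`. [folklore] -/
theorem pow_mem_of_closed (σ₁ σ₂ : Equiv.Perm V) (S : Finset V) (hS : ∀ i ∈ S, ∃ j ∈ S, σ₁ j = σ₂ i)
    {a : V} (ha : a ∈ S) : ∀ n : ℕ, ((σ₁⁻¹ * σ₂) ^ n) a ∈ S := by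
  intro n
  induction n with
  | zero => simpa using ha
  | succ n ih =>
    obtain ⟨j, hj, hje⟩ := hS _ ih
    rw [pow_succ', Equiv.Perm.mul_apply, Equiv.Perm.mul_apply, ← hje]
    simpa using hj

omit [DecidableEq V] in
/-- **LENS RIGIDITY.**  Let `σ₁⁻¹σ₂` be a cycle and `S` a set of nodes such that every `σ₂`-image of `S` is a `σ₁`-image of `S`
(`σ₂ S ⊆ σ₁ S`).  If `σ₁` and `σ₂` differ at some node of `S`, then they agree at every node outside `S`.  (The support of the single
cycle `σ₁⁻¹σ₂` meets the invariant set `S`, hence lies inside it.) [this seat's lemma; folklore group theory] -/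
theorem agree_off_of_isCycle (σ₁ σ₂ : Equiv.Perm V) (hc : (σ₁⁻¹ * σ₂).IsCycle) (S : Finset V)
    (hS : ∀ i ∈ S, ∃ j ∈ S, σ₁ j = σ₂ i) {a : V} (ha : a ∈ S) (hne : σ₁ a ≠ σ₂ a) :
    ∀ b, b ∉ S → σ₁ b = σ₂ b := by
  intro b hb
  by_contra hneb
  have hca : (σ₁⁻¹ * σ₂) a ≠ a := by
    rw [Equiv.Perm.mul_apply, ne_eq, Equiv.Perm.inv_eq_iff_eq]; exact fun h => hne h.symm
  have hcb : (σ₁⁻¹ * σ₂) b ≠ b := by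
    rw [Equiv.Perm.mul_apply, ne_eq, Equiv.Perm.inv_eq_iff_eq]; exact fun h => hneb h.symm
  obtain ⟨n, hn⟩ := hc.exists_pow_eq hca hcb
  exact hb (hn ▸ pow_mem_of_closed σ₁ σ₂ S hS ha n)

omit [DecidableEq V] in
/-- **LENS RIGIDITY, two-sided form.**  With `σ₁⁻¹σ₂` a cycle and `σ₂ S ⊆ σ₁ S`: the two colours cannot differ both at a node of `S`
and at a node outside `S`. [this seat's lemma] -/
theorem not_lens_of_isCycle (σ₁ σ₂ : Equiv.Perm V) (hc : (σ₁⁻¹ * σ₂).IsCycle) (S : Finset V)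
    (hS : ∀ i ∈ S, ∃ j ∈ S, σ₁ j = σ₂ i) {a b : V} (ha : a ∈ S) (hne : σ₁ a ≠ σ₂ a) (hb : b ∉ S)
    (hneb : σ₁ b ≠ σ₂ b) : False :=
  hneb (agree_off_of_isCycle σ₁ σ₂ hc S hS ha hne b hb)


section Core

variable (ok : V → V → Prop) (w g : V → V → ℤ) (b : Fin 5 → V)

/-- **ACYCLICITY OF THE RELATIVE ARCS (height order, list form).**  In any realisation of the nested-triangle core there is no list
`l` of ≥ 2 distinct nodes avoiding `b0, b4` such that for every `i ∈ l` the arc from `i` to its cyclic successor in `l` is a relative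
arc of `σB`, `σC` or `σE` against `σZ` (`σZ (l.formPerm i) ∈ {σB i, σC i, σE i}`).  Equivalently the digraph `i → σZ⁻¹σX i`
(`X = B, C, E`) on `V ∖ {b0, b4}` has no directed cycle. [this seat's theorem; corollary of `core_BCEZ_unique`] -/
theorem core_noRelCycle (hb : Function.Injective b)
    (hoff : ∀ i j, j ≠ i → g i j = 0) (hmark : ∀ l, g (b l) (b l) = (2 : ℤ) ^ (l : ℕ)) (haux : ∀ i, (∀ l, b l ≠ i) → g i i = 0)
    {θB θC θE θZ : ℤ} {σB σC σE σZ : Equiv.Perm V} (hBC : θB < θC) (hCE : θC < θE) (hEZ : θE < θZ)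
    (hB : (∀ i, ok i (σB i)) ∧ ∀ τ : Equiv.Perm V, τ ≠ σB → (∀ i, ok i (τ i)) →
      ∑ i, (w i (τ i) + θB * g i (τ i)) < ∑ i, (w i (σB i) + θB * g i (σB i)))
    (hC : (∀ i, ok i (σC i)) ∧ ∀ τ : Equiv.Perm V, τ ≠ σC → (∀ i, ok i (τ i)) →
      ∑ i, (w i (τ i) + θC * g i (τ i)) < ∑ i, (w i (σC i) + θC * g i (σC i)))
    (hE : (∀ i, ok i (σE i)) ∧ ∀ τ : Equiv.Perm V, τ ≠ σE → (∀ i, ok i (τ i)) →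
      ∑ i, (w i (τ i) + θE * g i (τ i)) < ∑ i, (w i (σE i) + θE * g i (σE i)))
    (hZ : (∀ i, ok i (σZ i)) ∧ ∀ τ : Equiv.Perm V, τ ≠ σZ → (∀ i, ok i (τ i)) →
      ∑ i, (w i (τ i) + θZ * g i (τ i)) < ∑ i, (w i (σZ i) + θZ * g i (σZ i)))
    (hB0 : σB (b 0) ≠ b 0) (hB1 : σB (b 1) = b 1) (hB2 : σB (b 2) = b 2) (hB3 : σB (b 3) ≠ b 3) (hB4 : σB (b 4) ≠ b 4)
    (hC0 : σC (b 0) ≠ b 0) (hC1 : σC (b 1) = b 1) (hC2 : σC (b 2) ≠ b 2) (hC3 : σC (b 3) = b 3) (hC4 : σC (b 4) ≠ b 4)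
    (hE0 : σE (b 0) ≠ b 0) (hE1 : σE (b 1) ≠ b 1) (hE2 : σE (b 2) = b 2) (hE3 : σE (b 3) = b 3) (hE4 : σE (b 4) ≠ b 4)
    (hZ0 : σZ (b 0) = b 0) (hZ1 : σZ (b 1) ≠ b 1) (hZ2 : σZ (b 2) ≠ b 2) (hZ3 : σZ (b 3) ≠ b 3) (hZ4 : σZ (b 4) = b 4)
    (l : List V) (hl : l.Nodup) (h2 : 2 ≤ l.length) (h0 : b 0 ∉ l) (h4 : b 4 ∉ l)
    (harc : ∀ i ∈ l, σZ (l.formPerm i) = σB i ∨ σZ (l.formPerm i) = σC i ∨ σZ (l.formPerm i) = σE i) : False := by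
  set T : Equiv.Perm V := σZ * l.formPerm with hTdef
  have hTi : ∀ i, T i = σZ (l.formPerm i) := fun i => by rw [hTdef, Equiv.Perm.mul_apply]
  have hT : ∀ i, T i = σB i ∨ T i = σC i ∨ T i = σE i ∨ T i = σZ i := by
    intro i
    rw [hTi]
    by_cases hi : i ∈ l
    · rcases harc i hi with h | h | h
      · exact Or.inl h
      · exact Or.inr (Or.inl h)
      · exact Or.inr (Or.inr (Or.inl h))
    · rw [List.formPerm_apply_of_notMem hi]; exact Or.inr (Or.inr (Or.inr rfl))
  have hT0 : T (b 0) = b 0 := by rw [hTi, List.formPerm_apply_of_notMem h0, hZ0]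
  have hT4 : T (b 4) = b 4 := by rw [hTi, List.formPerm_apply_of_notMem h4, hZ4]
  have hTZ := core_BCEZ_unique ok w g b hb hoff hmark haux hBC hCE hEZ hB hC hE hZ hB0 hB1 hB2 hB3 hB4 hC0 hC1 hC2 hC3 hC4
    hE0 hE1 hE2 hE3 hE4 hZ0 hZ1 hZ2 hZ3 hZ4 T hT hT0 hT4
  have hform : l.formPerm = 1 := by
    have h1 : σZ * l.formPerm = σZ * 1 := by rw [mul_one]; exact hTZ
    exact mul_left_cancel h1
  have := (List.formPerm_eq_one_iff l hl).mp hform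
  omega

/-- **No relative 2-cycle.**  The length-two instance of `core_noRelCycle`: two distinct non-gate nodes `i ≠ j` with a relative arc
`i → j` (`σZ j ∈ {σB i, σC i, σE i}`) and a relative arc `j → i` cannot coexist. [this seat's lemma] -/
theorem core_noRelTwoCycle (hb : Function.Injective b)
    (hoff : ∀ i j, j ≠ i → g i j = 0) (hmark : ∀ l, g (b l) (b l) = (2 : ℤ) ^ (l : ℕ)) (haux : ∀ i, (∀ l, b l ≠ i) → g i i = 0)
    {θB θC θE θZ : ℤ} {σB σC σE σZ : Equiv.Perm V} (hBC : θB < θC) (hCE : θC < θE) (hEZ : θE < θZ)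
    (hB : (∀ i, ok i (σB i)) ∧ ∀ τ : Equiv.Perm V, τ ≠ σB → (∀ i, ok i (τ i)) →
      ∑ i, (w i (τ i) + θB * g i (τ i)) < ∑ i, (w i (σB i) + θB * g i (σB i)))
    (hC : (∀ i, ok i (σC i)) ∧ ∀ τ : Equiv.Perm V, τ ≠ σC → (∀ i, ok i (τ i)) →
      ∑ i, (w i (τ i) + θC * g i (τ i)) < ∑ i, (w i (σC i) + θC * g i (σC i)))
    (hE : (∀ i, ok i (σE i)) ∧ ∀ τ : Equiv.Perm V, τ ≠ σE → (∀ i, ok i (τ i)) →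
      ∑ i, (w i (τ i) + θE * g i (τ i)) < ∑ i, (w i (σE i) + θE * g i (σE i)))
    (hZ : (∀ i, ok i (σZ i)) ∧ ∀ τ : Equiv.Perm V, τ ≠ σZ → (∀ i, ok i (τ i)) →
      ∑ i, (w i (τ i) + θZ * g i (τ i)) < ∑ i, (w i (σZ i) + θZ * g i (σZ i)))
    (hB0 : σB (b 0) ≠ b 0) (hB1 : σB (b 1) = b 1) (hB2 : σB (b 2) = b 2) (hB3 : σB (b 3) ≠ b 3) (hB4 : σB (b 4) ≠ b 4)
    (hC0 : σC (b 0) ≠ b 0) (hC1 : σC (b 1) = b 1) (hC2 : σC (b 2) ≠ b 2) (hC3 : σC (b 3) = b 3) (hC4 : σC (b 4) ≠ b 4)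
    (hE0 : σE (b 0) ≠ b 0) (hE1 : σE (b 1) ≠ b 1) (hE2 : σE (b 2) = b 2) (hE3 : σE (b 3) = b 3) (hE4 : σE (b 4) ≠ b 4)
    (hZ0 : σZ (b 0) = b 0) (hZ1 : σZ (b 1) ≠ b 1) (hZ2 : σZ (b 2) ≠ b 2) (hZ3 : σZ (b 3) ≠ b 3) (hZ4 : σZ (b 4) = b 4)
    {i j : V} (hij : i ≠ j) (hi0 : i ≠ b 0) (hi4 : i ≠ b 4) (hj0 : j ≠ b 0) (hj4 : j ≠ b 4)
    (hij' : σZ j = σB i ∨ σZ j = σC i ∨ σZ j = σE i) (hji' : σZ i = σB j ∨ σZ i = σC j ∨ σZ i = σE j) : False := by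
  refine core_noRelCycle ok w g b hb hoff hmark haux hBC hCE hEZ hB hC hE hZ hB0 hB1 hB2 hB3 hB4 hC0 hC1 hC2 hC3 hC4
    hE0 hE1 hE2 hE3 hE4 hZ0 hZ1 hZ2 hZ3 hZ4 [i, j] (by simp [hij]) (by simp) (by simp [Ne.symm hi0, Ne.symm hj0])
    (by simp [Ne.symm hi4, Ne.symm hj4]) ?_
  intro k hk
  rw [List.formPerm_pair]
  simp only [List.mem_cons, List.not_mem_nil, or_false] at hk
  rcases hk with rfl | rfl
  · rw [Equiv.swap_apply_left]; exact hij'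
  · rw [Equiv.swap_apply_right]; exact hji'

end Core

end Core
end MarkedEdge
end Summit.ValiantsHypothesis.ValiantsHypothesis.Theorems.KPlusLogSqLaw
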